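import Summits.NavierStokesRegularity.FluidComputer.BlockEnergyContinuity
import HarnessLib

/-!
# Fluid computer — the SIGNED block energy identity along a maximal smooth solution (flux form of the balance)

HONEST FRAMING (cell `pub-fluidc`, verbatim): *low prior, high value-of-information experiment on Tao's
machine paradigm; NOT a claim that NS blows up.* Theorem side of the cell (support of the flux face of the level
dictionary); nothing here is evidence of blow-up.

`BlockEnergyTransport` / `BlockEnergyDissipation` / `BlockViscousRent` carried Cheskidov–Shvydkoy's block balance
`(1/2) d/dt ‖Δ̇_j u‖₂² + ν ∑_i ‖∂_i Δ̇_j u‖₂² = −N_j(u)` (`N_j(w) = ∫ ⟪Δ̇_j w, Δ̇_j((w·∇)w)⟫`) from Leray's regular local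
solutions to the maximal solution as INEQUALITIES with the POSITIVE PART `(−N_j)⁺` under a lower integral — enough for
floors, ceilings and rents level by level, but not for FLUXES: the energy flux through a level is a SIGNED sum
`Π_J = −∑_{j ≥ J} N_j`, in which energy merely passing through the band cancels. This file supplies the exact, signed
identity along the maximal solution, with honest (Bochner) time integrals:

* `piece_blockEnergy_eq` — the local step: on a piece controlled by one of Leray's regular local solutions the
  identity holds for `u` itself, and the two time integrands `τ ↦ N_j(u(τ))`, `τ ↦ S_j(u(τ)) = ∑_i ‖∂_i Δ̇_j u(τ)‖₂²`
  are interval-integrable (`BlockEnergyDissipation.integrableOn_transfer`, `IsSmoothSlabSolution.intervalIntegrable_rhs`);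
* `blockL2_sq_toReal_sub_eq` (**THE SIGNED BALANCE**) — for every maximal smooth solution `(u, p)` on `ℝ³ × [0, T)`
  (`ν > 0`), Leray–Hopf from `u 0`, all `0 < s ≤ t < T` and every level `j`: `N_j ∘ u` and `S_j ∘ u` are
  interval-integrable on `[s, t]` and
  `‖Δ̇_j u(t)‖₂² − ‖Δ̇_j u(s)‖₂² = 2 ∫_s^t ( −ν S_j(u(τ)) − N_j(u(τ)) ) dτ` (real numbers; chaining of pieces, the interval
  integrals adding over adjacent intervals);
* `neg_integral_transfer_ge` (**SIGNED FEEDING ≥ VISCOUS RENT − STOCK**, one level) — hence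
  `−∫_s^t N_j(u) ≥ ν ∫_s^t S_j(u) − ‖Δ̇_j u(s)‖₂²/2 ≥ (ν 4^j/(3C_r²)) ∫_s^t ‖Δ̇_j u(τ)‖₂² dτ − ‖Δ̇_j u(s)‖₂²/2`: the NET
  (signed) nonlinear feeding of a level over a window pays at least the level's viscous rent minus its initial stock —
  the signed sharpening of `BlockViscousRent.feeding_ge_rent`, summable over bands of levels (`LevelFluxFloor`).

0 sorry; no new definitions, no named facts (inputs: `leray_local_regular_H1_holds`, `serrin_weak_strong_uniqueness_holds`,
`isSmoothSlabSolution_of_regular`, `IsSmoothSlabSolution.blockEnergy_eq` / `intervalIntegrable_rhs`,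
`BlockEnergyDissipation.integrableOn_transfer`, `IsMaximalSmoothSolution.isH1RegularOn_Ioo`,
`BlockViscousRent.four_pow_mul_blockL2_sq_le`).

## References

* A. Cheskidov, R. Shvydkoy, Arch. Ration. Mech. Anal. 195 (2010) 159–169 = arXiv:0708.3067, Lemma 3.2 (proof, (8)).
  [CheskidovShvydkoy2010]
* A. Cheskidov, P. Constantin, S. Friedlander, R. Shvydkoy, *Energy conservation and Onsager's conjecture for the Euler
  equations*, Nonlinearity 21 (2008) 1233–1252 (the Littlewood–Paley energy flux — context). [CCFS2008]
* J. C. Robinson, J. L. Rodrigo, W. Sadowski, *The Three-Dimensional Navier–Stokes Equations*, CUP 2016, Thm. 6.10,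
  Thm. 8.17. [RobinsonRodrigoSadowski2016]
-/

noncomputable section

open MeasureTheory Set Function Filter Topology
open scoped ENNReal NNReal RealInnerProductSpace
open Literature.Analysis.FluidPDE Literature.Analysis.FunctionSpaces
open Literature.Analysis.FluidPDE.LPBounds (gradSq)
open Summit.NavierStokesRegularity.FluidComputer.BlockEnergyTransport
open Summit.NavierStokesRegularity.FluidComputer.BlockEnergyDissipation

namespace Summit.NavierStokesRegularity.FluidComputer.BlockEnergyIdentity

/-! ## Bookkeeping -/

/-- For a smooth `L²` field `w`: `‖Δ̇_j w‖₂²` (as `toReal`) is the real integral `∫ ‖Δ̇_j w‖²`, and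
`gradSq (Δ̇_j w) = ofReal (∑_i ∫ ‖∂_i Δ̇_j w‖²)`. [folklore] -/
theorem toReal_blockL2_sq_eq {w : EuclideanSpace ℝ (Fin 3) → EuclideanSpace ℝ (Fin 3)} (hw : IsSmoothL2Field w)
    (j : ℤ) :
    (blockL2 w j ^ 2).toReal = ∫ x, ‖blockFn j w x‖ ^ 2 ∧
      gradSq (blockFn j w) = ENNReal.ofReal (∑ i, ∫ x, ‖fderiv ℝ (blockFn j w) x
        (stdOrthonormalBasis ℝ (EuclideanSpace ℝ (Fin 3)) i)‖ ^ 2) := by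
  have hwj : IsSmoothL2Field (blockFn j w) := hw.blockFn j
  refine ⟨(integral_norm_sq_eq_toReal_eLpNorm_sq hwj.memLp_two.1).symm, ?_⟩
  have hfin' : ∀ i, eLpNorm (fun x => fderiv ℝ (blockFn j w) x
      (stdOrthonormalBasis ℝ (EuclideanSpace ℝ (Fin 3)) i)) 2 volume ^ 2 ≠ ∞ := fun i =>
    ENNReal.pow_ne_top (hwj.memLp_fderiv_apply _).eLpNorm_ne_top
  simp only [gradSq]
  rw [ENNReal.ofReal_sum_of_nonneg (fun i _ => integral_nonneg fun x => by positivity)]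
  refine Finset.sum_congr rfl fun i _ => ?_
  rw [integral_norm_sq_eq_toReal_eLpNorm_sq (hwj.memLp_fderiv_apply _).1, ENNReal.ofReal_toReal (hfin' i)]

/-! ## The local step: the signed identity on a regular piece -/

/-- **The signed block balance on a regular piece.** Setting of `BlockEnergyDissipation.piece_blockEnergy_visc`: a
classical solution `(u, p)` on `ℝ³ × [0, T)` (`ν > 0`), Leray–Hopf from `u 0`, a good restarting time `σ ∈ (0,T)` with
`‖∇u(σ)‖₂² ≤ A`, a lifespan `d > 0` with `σ + d ≤ T`, `A² d ≤ c₀ ν³` (`LerayLocalRegularH1With c₀`). Then for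
`σ < s ≤ t ≤ σ + d`, `t < T`, and every level `j`: the transfer `τ ↦ N_j(u(τ))` and the block dissipation
`τ ↦ S_j(u(τ)) = ∑_i ∫ ‖∂_i Δ̇_j u(τ)‖²` are interval-integrable on `[s, t]`, and
`‖Δ̇_j u(t)‖₂² − ‖Δ̇_j u(s)‖₂² = 2 ∫_s^t (−ν S_j(u(τ)) − N_j(u(τ))) dτ` (Cheskidov–Shvydkoy's (8), integrated, EXACT).
Along Leray's regular solution `v` from `u(σ)` this is `IsSmoothSlabSolution.blockEnergy_eq`; `u(σ + ·) = v` pointwise by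
weak–strong uniqueness and continuity. [cite: CheskidovShvydkoy2010, Lemma 3.2 (proof, (8))] -/
theorem piece_blockEnergy_eq {ν T : ℝ} (hν : 0 < ν)
    {u : ℝ → EuclideanSpace ℝ (Fin 3) → EuclideanSpace ℝ (Fin 3)} {p : ℝ → EuclideanSpace ℝ (Fin 3) → ℝ}
    (hcl : IsClassicalNSSolutionOn (Ico 0 T) ν 0 u p) (hLH : IsLerayHopfOn T ν 0 (u 0) u)
    {c₀ : ℝ} (hreg : LerayLocalRegularH1With c₀)
    {σ : ℝ} (hσ : σ ∈ Ioo 0 T) (hLHσ : IsLerayHopfOn (T - σ) ν 0 (u σ) (fun t => u (t + σ)))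
    {A d : ℝ} (hA : 0 ≤ A) (hAσ : eWeakGradL2Sq (u σ) ≤ ENNReal.ofReal A) (hd : 0 < d) (hσd : σ + d ≤ T)
    (hAd : A ^ 2 * d ≤ c₀ * ν ^ 3) :
    ∀ s t : ℝ, σ < s → s ≤ t → t ≤ σ + d → t < T → ∀ j : ℤ,
      IntervalIntegrable (fun τ => ∫ x, ⟪blockFn j (u τ) x, blockFn j (convect (u τ) (u τ)) x⟫) volume s t ∧
      IntervalIntegrable (fun τ => ∑ i, ∫ x, ‖fderiv ℝ (blockFn j (u τ)) x
        (stdOrthonormalBasis ℝ (EuclideanSpace ℝ (Fin 3)) i)‖ ^ 2) volume s t ∧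
      (blockL2 (u t) j ^ 2).toReal - (blockL2 (u s) j ^ 2).toReal =
        2 * ∫ τ in s..t, (-ν * (∑ i, ∫ x, ‖fderiv ℝ (blockFn j (u τ)) x
          (stdOrthonormalBasis ℝ (EuclideanSpace ℝ (Fin 3)) i)‖ ^ 2) -
          ∫ x, ⟪blockFn j (u τ) x, blockFn j (convect (u τ) (u τ)) x⟫) := by
  have hu2 : MemLp (u σ) 2 volume := hLH.memLp σ ⟨hσ.1.le, hσ.2.le⟩
  have hdiv : IsWeaklyDivFree (u σ) := hLHσ.isWeaklyDivFree_datum (sub_pos.2 hσ.2)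
  obtain ⟨v, q, hv, -, hvreg, hns, hclv⟩ := hreg hν hd hu2 hdiv hA hAσ hAd
  have hLHσ' : IsLerayHopfOn d ν 0 (u σ) (fun t => u (t + σ)) := hLHσ.of_le (by linarith)
  have hS : MemLqLp ∞ 6 v (Ioo 0 d) :=
    memLqLp_top_six_of_isH1RegularOn_Icc hvreg fun t ht => hv.memLp t ht
  have hqr : 2 / (∞ : ℝ≥0∞) + 3 / 6 ≤ 1 := by
    rw [ENNReal.div_top, zero_add]
    exact ENNReal.div_le_of_le_mul (by norm_num)
  have hae : ∀ t ∈ Ioc 0 d, u (t + σ) =ᵐ[volume] v t := fun t ht =>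
    serrin_weak_strong_uniqueness_holds hν hd hv hu2 (q := ∞) (r := 6) (by norm_num) hqr hS hLHσ' t ht
  have heq : ∀ τ ∈ Ioc σ (σ + d), τ < T → u τ = v (τ - σ) := by
    intro τ hτ hτT
    have h1 : u τ =ᵐ[volume] v (τ - σ) := by
      have h := hae (τ - σ) ⟨sub_pos.2 hτ.1, by linarith [hτ.2]⟩
      rwa [sub_add_cancel] at h
    have hcu : Continuous (u τ) := (hcl.contDiff_velocity ⟨hσ.1.le.trans hτ.1.le, hτT⟩).continuous
    have hcv : Continuous (v (τ - σ)) :=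
      (hns.contDiff_velocity ⟨sub_pos.2 hτ.1, by linarith [hτ.2]⟩).continuous
    exact (Continuous.ae_eq_iff_eq volume hcu hcv).1 h1
  -- uniform energy bound along `v`
  obtain ⟨E₀, hE₀⟩ := exists_eLpNorm_slice_le hv hν.le
  intro s t hs hst htd htT j
  -- notation for the integrands along `u` and `v`
  set Su : ℝ → ℝ := fun τ => ∑ i, ∫ x, ‖fderiv ℝ (blockFn j (u τ)) x
      (stdOrthonormalBasis ℝ (EuclideanSpace ℝ (Fin 3)) i)‖ ^ 2 with hSudef
  set Nu : ℝ → ℝ := fun τ => ∫ x, ⟪blockFn j (u τ) x, blockFn j (convect (u τ) (u τ)) x⟫ with hNudef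
  rcases hst.eq_or_lt with rfl | hst'
  · refine ⟨IntervalIntegrable.refl, IntervalIntegrable.refl, ?_⟩
    simp only [intervalIntegral.integral_same, mul_zero, sub_self]
  have ha' : 0 < s - σ := sub_pos.2 hs
  have hab' : s - σ < t - σ := by linarith
  have hb'd : t - σ ≤ d := by linarith
  obtain ⟨hSob, hSobdt, hsup, hp⟩ := hclv (s - σ) ha' (hab'.le.trans hb'd)
  have hslab : IsSmoothSlabSolution (s - σ) (t - σ) ν v q :=
    isSmoothSlabSolution_of_regular hns ha' hab' hb'd hSob hSobdt hsup hp
  have hE := hslab.blockEnergy_eq j le_rfl hab'.le le_rfl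
  -- uniform bounds on `[s - σ, d]`
  obtain ⟨M₀, hM₀'⟩ := hsup 0
  obtain ⟨M₁, hM₁'⟩ := hsup 1
  have hM₀ : ∀ τ ∈ Icc (s - σ) d, ∀ x, ‖v τ x‖ ≤ M₀ := fun τ hτ x => by
    simpa [norm_iteratedFDeriv_zero] using hM₀' τ hτ x
  have hM₁ : ∀ τ ∈ Icc (s - σ) d, ∀ x, ‖fderiv ℝ (v τ) x‖ ≤ M₁ := fun τ hτ x => by
    have h := hM₁' τ hτ x
    rwa [← norm_iteratedFDeriv_fderiv, norm_iteratedFDeriv_zero] at h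
  have hE₀' : ∀ τ ∈ Icc (s - σ) d, eLpNorm (v τ) 2 volume ≤ E₀ := fun τ hτ =>
    hE₀ τ ⟨ha'.le.trans hτ.1, hτ.2⟩
  -- the integrands along `v`
  set S : ℝ → ℝ := fun τ => ∑ i, ∫ x, ‖fderiv ℝ (blockFn j (v τ)) x
      (stdOrthonormalBasis ℝ (EuclideanSpace ℝ (Fin 3)) i)‖ ^ 2 with hSdef
  set N : ℝ → ℝ := fun τ => ∫ x, ⟪blockFn j (v τ) x, blockFn j (convect (v τ) (v τ)) x⟫ with hNdef
  have hNint : IntervalIntegrable N volume (s - σ) (t - σ) := by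
    refine IntegrableOn.intervalIntegrable ?_
    rw [uIcc_of_le hab'.le]
    exact integrableOn_transfer hns ha' hab'.le hb'd hM₀ hM₁ hE₀' j
  have hgint : IntervalIntegrable (fun τ => -ν * S τ - N τ) volume (s - σ) (t - σ) :=
    hslab.intervalIntegrable_rhs j le_rfl hab'.le le_rfl
  have hSint : IntervalIntegrable S volume (s - σ) (t - σ) := by
    have h := ((hgint.add hNint).neg).mul_const ν⁻¹
    refine h.congr fun τ _ => ?_
    simp only [Pi.neg_apply]
    field_simp
    ring
  -- `u = v (· - σ)` on `[s, t]`, hence the integrands agree there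
  have hequ : ∀ τ ∈ Icc s t, u τ = v (τ - σ) := fun τ hτ =>
    heq τ ⟨hs.trans_le hτ.1, hτ.2.trans htd⟩ (hτ.2.trans_lt htT)
  have hNeq : EqOn (fun τ => N (τ - σ)) Nu (Icc s t) := fun τ hτ => by
    simp only [hNdef, hNudef, hequ τ hτ]
  have hSeq : EqOn (fun τ => S (τ - σ)) Su (Icc s t) := fun τ hτ => by
    simp only [hSdef, hSudef, hequ τ hτ]
  have hIoc_sub : uIoc s t ⊆ Icc s t := by
    rw [uIoc_of_le hst'.le]; exact Ioc_subset_Icc_self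
  -- interval-integrability along `u`
  have hNu : IntervalIntegrable Nu volume s t := by
    have h := hNint.comp_sub_right σ
    rw [sub_add_cancel, sub_add_cancel] at h
    exact (intervalIntegrable_congr fun τ hτ => hNeq (hIoc_sub hτ)).1 h
  have hSu : IntervalIntegrable Su volume s t := by
    have h := hSint.comp_sub_right σ
    rw [sub_add_cancel, sub_add_cancel] at h
    exact (intervalIntegrable_congr fun τ hτ => hSeq (hIoc_sub hτ)).1 h
  refine ⟨hNu, hSu, ?_⟩
  -- the identity: translate the time integral and the energies
  have hsm : ∀ τ ∈ Icc (s - σ) (t - σ), IsSmoothL2Field (v τ) := fun τ hτ => hslab.smooth_slice τ hτ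
  have hEt : (blockL2 (u t) j ^ 2).toReal = ∫ x, ‖blockFn j (v (t - σ)) x‖ ^ 2 := by
    rw [hequ t ⟨hst'.le, le_rfl⟩]
    exact (toReal_blockL2_sq_eq (hsm _ ⟨hab'.le, le_rfl⟩) j).1
  have hEs : (blockL2 (u s) j ^ 2).toReal = ∫ x, ‖blockFn j (v (s - σ)) x‖ ^ 2 := by
    rw [hequ s ⟨le_rfl, hst'.le⟩]
    exact (toReal_blockL2_sq_eq (hsm _ ⟨le_rfl, hab'.le⟩) j).1
  have hint : ∫ τ in s..t, (-ν * Su τ - Nu τ) = ∫ τ in (s - σ)..(t - σ), (-ν * S τ - N τ) := by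
    rw [← intervalIntegral.integral_comp_sub_right (fun τ => -ν * S τ - N τ) σ]
    refine intervalIntegral.integral_congr fun τ hτ => ?_
    rw [uIcc_of_le hst'.le] at hτ
    simp only [← hNeq hτ, ← hSeq hτ]
  rw [hEt, hEs, hint]
  exact hE

/-! ## The covered, signed balance along the maximal solution -/

/-- **THE SIGNED BLOCK ENERGY BALANCE along a maximal smooth solution.** For every maximal smooth solution `(u, p)` of
the unforced Navier–Stokes system on `ℝ³ × [0, T)` (`ν > 0`) which is Leray–Hopf from `u 0`, all `0 < s ≤ t < T` and
every level `j ∈ ℤ`: the transfer `τ ↦ N_j(u(τ)) = ∫ ⟪Δ̇_j u(τ), Δ̇_j((u·∇)u)(τ)⟫` and the block dissipation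
`τ ↦ S_j(u(τ)) = ∑_i ∫ ‖∂_i Δ̇_j u(τ)‖²` are interval-integrable on `[s, t]`, and
`‖Δ̇_j u(t)‖₂² − ‖Δ̇_j u(s)‖₂² = 2 ∫_s^t ( −ν S_j(u(τ)) − N_j(u(τ)) ) dτ`
— Cheskidov–Shvydkoy's `(1/2) d/dt ‖u_q‖₂² + ν‖∇u_q‖₂² = −N_q`, integrated, EXACT and SIGNED, valid along the whole open
lifespan (a uniform `H¹` bound on `[s/2, t]` gives a uniform lifespan for Leray's regular local solutions from good
times; pieces of length `≤ δ/2` by `piece_blockEnergy_eq`, chained — interval integrals add over adjacent intervals).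
This is the form in which FLUXES through a level (signed sums over bands of levels) can be read.
[cite: CheskidovShvydkoy2010, Lemma 3.2 (proof, (8))] -/
theorem blockL2_sq_toReal_sub_eq {ν T : ℝ} (hν : 0 < ν) (hT : 0 < T)
    {u : ℝ → EuclideanSpace ℝ (Fin 3) → EuclideanSpace ℝ (Fin 3)} {p : ℝ → EuclideanSpace ℝ (Fin 3) → ℝ}
    (hmax : IsMaximalSmoothSolution ν 0 u p T) (hLH : IsLerayHopfOn T ν 0 (u 0) u)
    {s t : ℝ} (hs : 0 < s) (hst : s ≤ t) (htT : t < T) (j : ℤ) :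
    IntervalIntegrable (fun τ => ∫ x, ⟪blockFn j (u τ) x, blockFn j (convect (u τ) (u τ)) x⟫) volume s t ∧
    IntervalIntegrable (fun τ => ∑ i, ∫ x, ‖fderiv ℝ (blockFn j (u τ)) x
      (stdOrthonormalBasis ℝ (EuclideanSpace ℝ (Fin 3)) i)‖ ^ 2) volume s t ∧
    (blockL2 (u t) j ^ 2).toReal - (blockL2 (u s) j ^ 2).toReal =
      2 * ∫ τ in s..t, (-ν * (∑ i, ∫ x, ‖fderiv ℝ (blockFn j (u τ)) x
        (stdOrthonormalBasis ℝ (EuclideanSpace ℝ (Fin 3)) i)‖ ^ 2) -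
        ∫ x, ⟪blockFn j (u τ) x, blockFn j (convect (u τ) (u τ)) x⟫) := by
  set Su : ℝ → ℝ := fun τ => ∑ i, ∫ x, ‖fderiv ℝ (blockFn j (u τ)) x
      (stdOrthonormalBasis ℝ (EuclideanSpace ℝ (Fin 3)) i)‖ ^ 2 with hSudef
  set Nu : ℝ → ℝ := fun τ => ∫ x, ⟪blockFn j (u τ) x, blockFn j (convect (u τ) (u τ)) x⟫ with hNudef
  set g : ℝ → ℝ := fun τ => -ν * Su τ - Nu τ with hgdef
  set Es : ℝ → ℝ := fun τ => (blockL2 (u τ) j ^ 2).toReal with hEsdef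
  obtain ⟨c₀, hc₀, hreg⟩ := leray_local_regular_H1_holds
  have hH1 : IsH1RegularOn (Ioo 0 T) u := hmax.isH1RegularOn_Ioo hν hT hLH
  obtain ⟨M, hM, hMK⟩ := hH1.exists_forall_le (isCompact_Icc : IsCompact (Icc (s / 2) t))
    fun τ hτ => ⟨by linarith [hτ.1], hτ.2.trans_lt htT⟩
  set A : ℝ := M.toReal with hA
  set δ : ℝ := min (c₀ * ν ^ 3 / (A ^ 2 + 1)) (s / 2) with hδ
  have hδpos : 0 < δ := lt_min (div_pos (by positivity) (by positivity)) (by linarith)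
  have hδs : δ ≤ s / 2 := min_le_right _ _
  have hAδ : A ^ 2 * δ ≤ c₀ * ν ^ 3 := by
    calc A ^ 2 * δ ≤ A ^ 2 * (c₀ * ν ^ 3 / (A ^ 2 + 1)) := by gcongr; exact min_le_left _ _
      _ = c₀ * ν ^ 3 * (A ^ 2 / (A ^ 2 + 1)) := by ring
      _ ≤ c₀ * ν ^ 3 * 1 := by gcongr; rw [div_le_one (by positivity)]; linarith
      _ = c₀ * ν ^ 3 := mul_one _
  -- one piece of length `≤ δ/2`
  have single : ∀ s' t' : ℝ, s ≤ s' → s' ≤ t' → t' ≤ t → t' - s' ≤ δ / 2 →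
      IntervalIntegrable Nu volume s' t' ∧ IntervalIntegrable Su volume s' t' ∧
        Es t' - Es s' = 2 * ∫ τ in s'..t', g τ := by
    intro s' t' h1 h2 h3 h4
    obtain ⟨σ, hσ, hLHσ⟩ := hLH.exists_isLerayHopfOn_restart_Ioo hν.le (a := s' - δ / 2) (b := s')
      (by linarith) (by linarith) (by linarith)
    have hσT : σ ∈ Ioo 0 T := ⟨by linarith [hσ.1], by linarith [hσ.2]⟩
    have hAσ : eWeakGradL2Sq (u σ) ≤ ENNReal.ofReal A := by
      rw [hA, ENNReal.ofReal_toReal hM.ne]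
      exact (le_add_self).trans ((eH1NormSq_def (u σ)).symm.le.trans
        (hMK σ ⟨by linarith [hσ.1], by linarith [hσ.2]⟩))
    set d : ℝ := min δ (T - σ) with hd
    have hdpos : 0 < d := lt_min hδpos (sub_pos.2 hσT.2)
    have hσd : σ + d ≤ T := by linarith [min_le_right δ (T - σ)]
    have hAd : A ^ 2 * d ≤ c₀ * ν ^ 3 := (mul_le_mul_of_nonneg_left (min_le_left _ _) (sq_nonneg A)).trans hAδ
    have hpiece := piece_blockEnergy_eq hν hmax.1 hLH hreg hσT hLHσ ENNReal.toReal_nonneg hAσ hdpos hσd hAd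
    have ht'd : t' ≤ σ + d := by
      have : t' - σ ≤ d := le_min (by linarith [hσ.1]) (by linarith)
      linarith
    exact hpiece s' t' hσ.2 h2 ht'd (h3.trans_lt htT) j
  -- chaining
  have cover : ∀ n : ℕ, ∀ s' t' : ℝ, s ≤ s' → s' ≤ t' → t' ≤ t → t' - s' ≤ n * (δ / 2) →
      IntervalIntegrable Nu volume s' t' ∧ IntervalIntegrable Su volume s' t' ∧
        Es t' - Es s' = 2 * ∫ τ in s'..t', g τ := by
    intro n
    induction n with
    | zero =>
      intro s' t' h1 h2 h3 h4
      have h5 : t' = s' := by simp only [Nat.cast_zero, zero_mul] at h4; linarith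
      subst h5
      refine ⟨IntervalIntegrable.refl, IntervalIntegrable.refl, ?_⟩
      simp only [intervalIntegral.integral_same, mul_zero, sub_self]
    | succ n ih =>
      intro s' t' h1 h2 h3 h4
      by_cases hshort : t' - s' ≤ δ / 2
      · exact single s' t' h1 h2 h3 hshort
      push Not at hshort
      set m : ℝ := s' + δ / 2 with hm
      obtain ⟨hN1, hS1, hE1⟩ := single s' m h1 (by linarith) (by linarith) (by simp [hm])
      obtain ⟨hN2, hS2, hE2⟩ := ih m t' (by linarith) (by linarith) h3 (by push_cast at h4 ⊢; linarith)
      have hg1 : IntervalIntegrable g volume s' m := (hS1.const_mul (-ν)).sub hN1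
      have hg2 : IntervalIntegrable g volume m t' := (hS2.const_mul (-ν)).sub hN2
      refine ⟨hN1.trans hN2, hS1.trans hS2, ?_⟩
      rw [← intervalIntegral.integral_add_adjacent_intervals hg1 hg2]
      linarith
  obtain ⟨n, hn⟩ := exists_nat_ge ((t - s) / (δ / 2))
  have hδ2 : 0 < δ / 2 := by linarith
  rw [div_le_iff₀ hδ2] at hn
  exact cover n s t le_rfl hst le_rfl hn

/-! ## Signed feeding ≥ viscous rent − stock (one level) -/

/-- Reverse Bernstein in real form: `4^j ‖Δ̇_j w‖₂² ≤ 3 C_r² ∑_i ∫ ‖∂_i Δ̇_j w‖²` for smooth `L²` fields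
(`BlockViscousRent.four_pow_mul_blockL2_sq_le`). [cite: BahouriCheminDanchin2011, Lemma 2.1] -/
theorem four_pow_mul_toReal_blockL2_sq_le {w : EuclideanSpace ℝ (Fin 3) → EuclideanSpace ℝ (Fin 3)}
    (hw : IsSmoothL2Field w) (j : ℤ) :
    (4 : ℝ) ^ j * (blockL2 w j ^ 2).toReal ≤
      3 * ((lpBounds (Fin 3)).Cr : ℝ) ^ 2 * ∑ i, ∫ x, ‖fderiv ℝ (blockFn j w) x
        (stdOrthonormalBasis ℝ (EuclideanSpace ℝ (Fin 3)) i)‖ ^ 2 := by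
  have h := BlockViscousRent.four_pow_mul_blockL2_sq_le hw j
  obtain ⟨h1, h2⟩ := toReal_blockL2_sq_eq hw j
  rw [h2] at h
  have hS0 : 0 ≤ ∑ i, ∫ x, ‖fderiv ℝ (blockFn j w) x (stdOrthonormalBasis ℝ (EuclideanSpace ℝ (Fin 3)) i)‖ ^ 2 :=
    Finset.sum_nonneg fun i _ => integral_nonneg fun x => by positivity
  have hfin : blockL2 w j ^ 2 ≠ ∞ := ENNReal.pow_ne_top ((hw.blockFn j).memLp_two).eLpNorm_ne_top
  have htop : 3 * ((lpBounds (Fin 3)).Cr : ℝ≥0∞) ^ 2 * ENNReal.ofReal (∑ i, ∫ x, ‖fderiv ℝ (blockFn j w) x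
      (stdOrthonormalBasis ℝ (EuclideanSpace ℝ (Fin 3)) i)‖ ^ 2) ≠ ∞ :=
    ENNReal.mul_ne_top (ENNReal.mul_ne_top (by norm_num) (ENNReal.pow_ne_top ENNReal.coe_ne_top))
      ENNReal.ofReal_ne_top
  have h' := ENNReal.toReal_mono htop h
  have e1 : ((2 : ℝ≥0∞) ^ (2 * j)).toReal = (4 : ℝ) ^ j := by
    have e0 : (2 : ℝ≥0∞) ^ (2 * j) = (((2 : ℝ≥0) ^ (2 * j) : ℝ≥0) : ℝ≥0∞) := by
      rw [ENNReal.coe_zpow two_ne_zero]; norm_num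
    rw [e0, ENNReal.coe_toReal]
    push_cast
    rw [zpow_mul]; norm_num
  simp only [ENNReal.toReal_mul, ENNReal.toReal_ofReal hS0, e1, ENNReal.toReal_pow, ENNReal.coe_toReal,
    ENNReal.toReal_ofNat] at h'
  rw [ENNReal.toReal_pow]
  exact h'

/-- **SIGNED FEEDING ≥ VISCOUS RENT − STOCK (one level).** For every maximal smooth solution `(u, p)` of the unforced
Navier–Stokes system on `ℝ³ × [0, T)` (`ν > 0`) which is Leray–Hopf from `u 0`, all `0 < s ≤ t < T` and every level
`j ∈ ℤ`: `−∫_s^t N_j(u(τ)) dτ ≥ ν ∫_s^t S_j(u(τ)) dτ − ‖Δ̇_j u(s)‖₂²/2 ≥ (ν 4^j/(3 C_r²)) ∫_s^t ‖Δ̇_j u(τ)‖₂² dτ − ‖Δ̇_j u(s)‖₂²/2`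
— the NET nonlinear feeding of a level over a window (signed: energy handed in minus energy handed on) pays at least the
level's viscous rent at rate `ν k_j²/(3C_r²)` times its energy-time, minus the initial stock. Unlike
`BlockViscousRent.feeding_ge_rent` (positive part of the feeding) this form ADDS over bands of levels, giving the flux
face of the dictionary (`LevelFluxFloor`). [cite: CheskidovShvydkoy2010, Lemma 3.2 (proof, (8))] -/
theorem neg_integral_transfer_ge {ν T : ℝ} (hν : 0 < ν) (hT : 0 < T)
    {u : ℝ → EuclideanSpace ℝ (Fin 3) → EuclideanSpace ℝ (Fin 3)} {p : ℝ → EuclideanSpace ℝ (Fin 3) → ℝ}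
    (hmax : IsMaximalSmoothSolution ν 0 u p T) (hLH : IsLerayHopfOn T ν 0 (u 0) u)
    {s t : ℝ} (hs : 0 < s) (hst : s ≤ t) (htT : t < T) (j : ℤ) :
    ν * (∫ τ in s..t, ∑ i, ∫ x, ‖fderiv ℝ (blockFn j (u τ)) x
        (stdOrthonormalBasis ℝ (EuclideanSpace ℝ (Fin 3)) i)‖ ^ 2) - (blockL2 (u s) j ^ 2).toReal / 2 ≤
      -∫ τ in s..t, ∫ x, ⟪blockFn j (u τ) x, blockFn j (convect (u τ) (u τ)) x⟫ ∧
    ν * (4 : ℝ) ^ j / (3 * ((lpBounds (Fin 3)).Cr : ℝ) ^ 2) * ∫ τ in s..t, (blockL2 (u τ) j ^ 2).toReal ≤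
      ν * ∫ τ in s..t, (∑ i, ∫ x, ‖fderiv ℝ (blockFn j (u τ)) x
        (stdOrthonormalBasis ℝ (EuclideanSpace ℝ (Fin 3)) i)‖ ^ 2) := by
  obtain ⟨hN, hS, hE⟩ := blockL2_sq_toReal_sub_eq hν hT hmax hLH hs hst htT j
  rw [intervalIntegral.integral_sub (hS.const_mul (-ν)) hN, intervalIntegral.integral_const_mul] at hE
  have hEt : 0 ≤ (blockL2 (u t) j ^ 2).toReal := ENNReal.toReal_nonneg
  refine ⟨by linarith, ?_⟩
  -- reverse Bernstein under the time integral
  have hS0 : 0 ≤ ∫ τ in s..t, (∑ i, ∫ x, ‖fderiv ℝ (blockFn j (u τ)) x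
      (stdOrthonormalBasis ℝ (EuclideanSpace ℝ (Fin 3)) i)‖ ^ 2) :=
    intervalIntegral.integral_nonneg hst fun τ _ =>
      Finset.sum_nonneg fun i _ => integral_nonneg fun x => by positivity
  by_cases hCr0 : ((lpBounds (Fin 3)).Cr : ℝ) = 0
  · -- degenerate constant: the left-hand side vanishes
    have : ν * (4 : ℝ) ^ j / (3 * ((lpBounds (Fin 3)).Cr : ℝ) ^ 2) = 0 := by rw [hCr0]; simp
    rw [this, zero_mul]
    exact mul_nonneg hν.le hS0
  have hCrpos : 0 < 3 * ((lpBounds (Fin 3)).Cr : ℝ) ^ 2 := by positivity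
  have hptw : ∀ τ ∈ Icc s t, (4 : ℝ) ^ j / (3 * ((lpBounds (Fin 3)).Cr : ℝ) ^ 2) * (blockL2 (u τ) j ^ 2).toReal ≤
      ∑ i, ∫ x, ‖fderiv ℝ (blockFn j (u τ)) x (stdOrthonormalBasis ℝ (EuclideanSpace ℝ (Fin 3)) i)‖ ^ 2 := by
    intro τ hτ
    have hw : IsSmoothL2Field (u τ) :=
      isSmoothL2Field_slice_of_maximal hν hT hmax hLH ⟨hs.trans_le hτ.1, hτ.2.trans_lt htT⟩
    have h := four_pow_mul_toReal_blockL2_sq_le hw j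
    rw [div_mul_eq_mul_div, div_le_iff₀ hCrpos]
    linarith
  have hEs : IntervalIntegrable (fun τ => (blockL2 (u τ) j ^ 2).toReal) volume s t := by
    refine ContinuousOn.intervalIntegrable ?_
    rw [uIcc_of_le hst]
    refine ENNReal.continuousOn_toReal.comp
      ((BlockEnergyContinuity.continuousOn_blockL2_sq hν hT hmax hLH j).mono
        fun τ hτ => ⟨hs.trans_le hτ.1, hτ.2.trans_lt htT⟩) fun τ hτ => ?_
    exact ENNReal.pow_ne_top ((isSmoothL2Field_slice_of_maximal hν hT hmax hLH
      ⟨hs.trans_le hτ.1, hτ.2.trans_lt htT⟩).blockFn j).memLp_two.eLpNorm_ne_top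
  have hmono := intervalIntegral.integral_mono_on hst (hEs.const_mul _) hS hptw
  rw [intervalIntegral.integral_const_mul] at hmono
  calc ν * (4 : ℝ) ^ j / (3 * ((lpBounds (Fin 3)).Cr : ℝ) ^ 2) * ∫ τ in s..t, (blockL2 (u τ) j ^ 2).toReal
      = ν * ((4 : ℝ) ^ j / (3 * ((lpBounds (Fin 3)).Cr : ℝ) ^ 2) * ∫ τ in s..t, (blockL2 (u τ) j ^ 2).toReal) := by
        ring
    _ ≤ ν * ∫ τ in s..t, (∑ i, ∫ x, ‖fderiv ℝ (blockFn j (u τ)) x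
        (stdOrthonormalBasis ℝ (EuclideanSpace ℝ (Fin 3)) i)‖ ^ 2) := mul_le_mul_of_nonneg_left hmono hν.le

end Summit.NavierStokesRegularity.FluidComputer.BlockEnergyIdentity

end
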